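import Mathlib
import HarnessLib
import Summits.HubbardSuperconductivity.HubbardSuperconductivity.Theorems.KLProgrammeKLRegimeAlphaWtSectionalFlowDeep

/-!
# K3 VL child `KLRegimeVolumeLimitV17F2` (stmt-HubbardSuperconductivity-20440), blueprint v5 M3b-j (i)/(ii) AT A COMMON FRAME ON TWO LATTICES: `α_w` and the
# SECTIONAL row `eW′` for the sector covariance sampled on ANY lattice `V` at the COARSE volume's flow frame `K_n = klFlowFrameU L M β U μ n`, deep window

Cell `gate-hubbard-kl`, seat p3 (g12).  k3c4-p1's M5 step at the model's covariances (`…TwoVolumeModelScaleSucc.model_sum_norm_kernel_twoVolume_scaleSucc_composite_le`)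
instantiates BOTH step covariances at a COMMON frame `K` — the coarse volume's top frame — on the two lattices `V ∈ {L, L″ = bL}`:
`CL_V = S_V(F̃_j[K])ᵀ · C^{K}_{(Λ_{j+2},Λ_{j+1}]}(V) · S_V(F̃_j[K])`, and reads `ScaleCovData CL_V Λ κ_V αW_V sW_V` (both) and `ScaleCovSecData CL_{L″} Λ eW′` (fine).
The flow-frame doors `alphaWt_klSliceCov_bgmFat_klEng_flow_deep` (p3 g11) and `secWt_klSliceCov_bgmFat_klEng_flow_deep` (p3 g12) tie the covariance's lattice to
the frame's; this file DECOUPLES them: the regime doors `alphaWt_klSliceCov_bgmFat_of_thresholds` / `secWt_klSliceCov_bgmFat_of_thresholds` take ANY admissible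
frame and ANY lattice with `β² ≤ V`, `β ≤ M`, and the order-three data of `K_n` (`klFlowFrameU_thirdOrder_data`) are functions on momentum space, lattice-free.

* **`alphaWt_klSliceCov_bgmFat_klEng_flow_deep_vol (j d)`** — `α_w` (klScaleWt-weighted rows AND columns `≤ Cα·(M/β)/Λ_{nf+j}`) of
  `S_V(F̃_nf[K_n])ᵀ·klSliceCov_V (nf+j)[K_n]·S_V(F̃_nf[K_n])` on every lattice `V` with `klEngL₃ β U ≤ V`, `K_n` the flow frame of the history's volume `L`;
* **`secWt_klSliceCov_bgmFat_klEng_flow_deep_vol (j d)`** — the SECTIONAL Λ_w-scaled row `≤ Ce` of the same matrix, every rate `0 ≤ Λ_w ≤ Λ_{nf+j}`;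
* **`scaleCovSecData_klSliceCov_bgmFat_klEng_flow_deep_vol (j d)`** — the latter BUNDLED as `TwoVolumeDefect.ScaleCovSecData … Λ_w Ce` (M5's `hCsec` BY NAME at
  `V := L″`, `nf := j`, door `j := 2`, i.e. `klSliceCov_V (j+2) = C^{K}_{(Λ_{j+2},Λ_{j+1}]}(V)` by `rfl` on `klSliceCov`).
Binders = those of `E4FlowAt` / `stub_engine_step_norms` at volume `L` plus `klEngL₃ β U ≤ V`; constants per `(j, d)`, `R`-free, `U`-free, `L`/`V`-free.

Everything is proved; no definitions. [cite: BenfattoGiulianiMastropietro2006, §2.8 (2.81), §3 (3.3)]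
-/

noncomputable section

namespace Summit.HubbardSuperconductivity.HubbardSuperconductivity.Theorems.TorusFourierL2

set_option linter.dupNamespace false -- summit = problem name (single-conjunct summit), D-0017

open Set Finset Literature.MathematicalPhysics.QuantumLattice Literature.MathematicalPhysics.QuantumLattice.BandSectorCounting
open Literature.MathematicalPhysics.QuantumLattice.FermiRG Literature.Probability.LatticeModels Literature.Analysis.SpecialFunctions
open Summit.HubbardSuperconductivity.HubbardSuperconductivity.Theorems.DispersionFlow
open Summit.HubbardSuperconductivity.HubbardSuperconductivity.Theorems.KLRegimeSplit
open Summit.HubbardSuperconductivity.HubbardSuperconductivity.Theorems.KLProgrammeLegKernels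
open Summit.HubbardSuperconductivity.HubbardSuperconductivity.Theorems.PerturbedFermiCurve
open Summit.HubbardSuperconductivity.HubbardSuperconductivity.Theorems.KLRegimeWick
open Summit.HubbardSuperconductivity.HubbardSuperconductivity.Theorems.EngineV8
open scoped Real Nat

open Classical

set_option maxHeartbeats 800000 in -- long binder list
/-- **`α_w` at the coarse flow frame `K_n`, covariance sampled on ANY lattice `V` (`klEngL₃ β U ≤ V`), DEEP WINDOW** (see the module docstring): the
`klScaleWt`-weighted rows and columns of `S_V(F̃_nf[K_n])ᵀ·klSliceCov_V (nf+j)[K_n]·S_V(F̃_nf[K_n])` are `≤ Cα·(M/β)/Λ_{nf+j}` for every weight scale `nw ≥ nf + j`;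
one constant per `(j, d)` (M5's `ScaleCovData.row/col` inputs on both lattices, up to `…TwoVolumeDataKitWt` §1).
[cite: BenfattoGiulianiMastropietro2006, §2.8 (2.81), §3 (3.3)] -/
theorem alphaWt_klSliceCov_bgmFat_klEng_flow_deep_vol (j dd : ℕ) :
    ∃ Cα : ℝ, 0 < Cα ∧
      ∀ (G : GeoConsts) (P : SplitConsts) (R : RenConsts) (Q : EngConsts) (cc : ℝ), R.WF2 → 0 < cc → cc ≤ EngineV8.klEngC₃6 P R →
      ∀ μ ∈ klWindowC, ∀ U : ℝ, 0 < U → U ≤ min (EngineV8.klEngU₀3 P R cc) (1 / (R.Gfr 3 + 1)) →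
      ∀ β : ℝ, klBetaMin ≤ β → β ≤ Real.exp (cc / U ^ 2) →
      ∀ (L M : ℕ) [NeZero L] [NeZero M], EngineV8.klEngL₃ β U ≤ L → EngineV8.klEngM₃ β U L ≤ M →
      ∀ n : ℕ, 1 ≤ n → n ≤ nScales β + 1 →
        HistP klPredsV17F2 L M G P Q R β U μ 0 n → FrameOK R U (nScales β) μ (klFlowFrameU L M β U μ n) →
        ∀ (V : ℕ) [NeZero V], EngineV8.klEngL₃ β U ≤ V →
        ∀ nf : ℕ, 1 ≤ nf → nf + j ≤ nScales β + 1 → (4 : ℝ) ^ (n + 2) * U ≤ (4 : ℝ) ^ (2 * nf + dd) → ∀ nw : ℕ, nf + j ≤ nw →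
        (∀ Y : SpaceTimeIdx V M × SectorLeg (sectorCount nf),
          ∑ Y', ‖((sectorSubMatrix V M β (bgmFatMultiplier V M klE0 β (nambuXiCT V μ (klFlowFrameU L M β U μ n)) nf)).transpose *
            klSliceCov V M β μ (klFlowFrameU L M β U μ n) (nf + j) *
            sectorSubMatrix V M β (bgmFatMultiplier V M klE0 β (nambuXiCT V μ (klFlowFrameU L M β U μ n)) nf)) Y Y'‖ *
              EngineV8.klScaleWt V M β nw {EngineV8.latticeLegPos (2 * (2 * M)) Y, EngineV8.latticeLegPos (2 * (2 * M)) Y'} ≤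
            Cα * ((M : ℝ) / β) / klScale klE0 (nf + j)) ∧
        (∀ Y' : SpaceTimeIdx V M × SectorLeg (sectorCount nf),
          ∑ Y, ‖((sectorSubMatrix V M β (bgmFatMultiplier V M klE0 β (nambuXiCT V μ (klFlowFrameU L M β U μ n)) nf)).transpose *
            klSliceCov V M β μ (klFlowFrameU L M β U μ n) (nf + j) *
            sectorSubMatrix V M β (bgmFatMultiplier V M klE0 β (nambuXiCT V μ (klFlowFrameU L M β U μ n)) nf)) Y Y'‖ *
              EngineV8.klScaleWt V M β nw {EngineV8.latticeLegPos (2 * (2 * M)) Y, EngineV8.latticeLegPos (2 * (2 * M)) Y'} ≤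
            Cα * ((M : ℝ) / β) / klScale klE0 (nf + j)) := by
  have ha : (-4 : ℝ) < -(6 / 5) := by norm_num
  have hab : (-(6 / 5) : ℝ) ≤ -(1 / 10) := by norm_num
  have hb : (-(1 / 10) : ℝ) < 0 := by norm_num
  obtain ⟨Cα, hCα, h⟩ := alphaWt_klSliceCov_bgmFat_of_thresholds ha hab hb j ((4 : ℝ) ^ dd / 3072) (1 / 16 + (4 : ℝ) ^ dd / 3072)
  refine ⟨Cα, hCα, ?_⟩
  intro G P R Q cc hR2 hcc hcc6 μ hμ U hU hUle β hβmin hβc L M _ _ hL3 hM3 n hn1 hnN hhist hfr V _ hV3 nf hnf hnfN hwin nw hnw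
  have hRj : ∀ i, 0 ≤ R.Gfr i := EngineV8.gfr_nonneg_of_wf2 hR2
  have hcle := (hcc6.trans (EngineV8.klEngC₃6_le_klEngC₃3 P R)).trans (EngineV8.klEngC₃3_le_symbolC₃ ha hab hb P hRj)
  have hU3 := (hUle.trans (min_le_left _ _)).trans (EngineV8.klEngU₀3_le_symbolU₀ ha hab hb P hRj cc)
  have hUG : U ≤ 1 / (R.Gfr 3 + 1) := hUle.trans (min_le_right _ _)
  have hVβ : β ^ 2 ≤ (V : ℝ) := EngineV8.sq_le_of_klEngL₃_le hV3
  have hMβ : β ≤ (M : ℝ) := EngineV8.le_of_klEngM₃_le hβmin hL3 hM3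
  obtain ⟨A₃, K₃, hA3, hK3, hdatA, hdatK⟩ := klFlowFrameU_thirdOrder_data (j := j) hR2 hU hUG hn1 hhist hnf hwin
  exact h R hRj cc U hcc hcle hU hU3 β hβmin hβc μ hμ _ hfr A₃ K₃ hA3 hK3 V M hVβ hMβ nf hnf hnfN hdatA hdatK nw hnw

set_option maxHeartbeats 800000 in -- long binder list
/-- **The SECTIONAL Λ-scaled row at the coarse flow frame `K_n`, covariance sampled on ANY lattice `V` (`klEngL₃ β U ≤ V`), DEEP WINDOW**: for every rate
`0 ≤ Λ_w ≤ Λ_{nf+j}`, leg `X`, time slice `t`, label `ℓ`, `Σ_y ‖(S_V(F̃_nf)ᵀ·klSliceCov_V (nf+j)·S_V(F̃_nf))[K_n] X ((t,y),ℓ)‖·(1 + Λ_w·tnorm(x⃗ − y)) ≤ Ce`;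
one constant per `(j, d)`, ε-free (M5's `hCsec` at the fine lattice). [cite: BenfattoGiulianiMastropietro2006, §2.8 (2.81), §3 (3.3)] -/
theorem secWt_klSliceCov_bgmFat_klEng_flow_deep_vol (j dd : ℕ) :
    ∃ Ce : ℝ, 0 < Ce ∧
      ∀ (G : GeoConsts) (P : SplitConsts) (R : RenConsts) (Q : EngConsts) (cc : ℝ), R.WF2 → 0 < cc → cc ≤ EngineV8.klEngC₃6 P R →
      ∀ μ ∈ klWindowC, ∀ U : ℝ, 0 < U → U ≤ min (EngineV8.klEngU₀3 P R cc) (1 / (R.Gfr 3 + 1)) →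
      ∀ β : ℝ, klBetaMin ≤ β → β ≤ Real.exp (cc / U ^ 2) →
      ∀ (L M : ℕ) [NeZero L] [NeZero M], EngineV8.klEngL₃ β U ≤ L → EngineV8.klEngM₃ β U L ≤ M →
      ∀ n : ℕ, 1 ≤ n → n ≤ nScales β + 1 →
        HistP klPredsV17F2 L M G P Q R β U μ 0 n → FrameOK R U (nScales β) μ (klFlowFrameU L M β U μ n) →
        ∀ (V : ℕ) [NeZero V], EngineV8.klEngL₃ β U ≤ V →
        ∀ nf : ℕ, 1 ≤ nf → nf + j ≤ nScales β + 1 → (4 : ℝ) ^ (n + 2) * U ≤ (4 : ℝ) ^ (2 * nf + dd) →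
        ∀ Λw : ℝ, 0 ≤ Λw → Λw ≤ klScale klE0 (nf + j) →
        ∀ (X : SpaceTimeIdx V M × SectorLeg (sectorCount nf)) (t : ImagTimeIdx M) (ℓ : SectorLeg (sectorCount nf)),
          ∑ y : TorusSite 2 V, ‖((sectorSubMatrix V M β (bgmFatMultiplier V M klE0 β (nambuXiCT V μ (klFlowFrameU L M β U μ n)) nf)).transpose *
            klSliceCov V M β μ (klFlowFrameU L M β U μ n) (nf + j) *
            sectorSubMatrix V M β (bgmFatMultiplier V M klE0 β (nambuXiCT V μ (klFlowFrameU L M β U μ n)) nf)) X ((t, y), ℓ)‖ *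
              (1 + Λw * (Torus.tnorm (X.1.2 - y) : ℝ)) ≤ Ce := by
  have ha : (-4 : ℝ) < -(6 / 5) := by norm_num
  have hab : (-(6 / 5) : ℝ) ≤ -(1 / 10) := by norm_num
  have hb : (-(1 / 10) : ℝ) < 0 := by norm_num
  obtain ⟨Ce, hCe, h⟩ := secWt_klSliceCov_bgmFat_of_thresholds ha hab hb j ((4 : ℝ) ^ dd / 3072) (1 / 16 + (4 : ℝ) ^ dd / 3072)
  refine ⟨Ce, hCe, ?_⟩
  intro G P R Q cc hR2 hcc hcc6 μ hμ U hU hUle β hβmin hβc L M _ _ hL3 hM3 n hn1 hnN hhist hfr V _ hV3 nf hnf hnfN hwin Λw hΛw0 hΛwle X t ℓ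
  have hRj : ∀ i, 0 ≤ R.Gfr i := EngineV8.gfr_nonneg_of_wf2 hR2
  have hcle := (hcc6.trans (EngineV8.klEngC₃6_le_klEngC₃3 P R)).trans (EngineV8.klEngC₃3_le_symbolC₃ ha hab hb P hRj)
  have hU3 := (hUle.trans (min_le_left _ _)).trans (EngineV8.klEngU₀3_le_symbolU₀ ha hab hb P hRj cc)
  have hUG : U ≤ 1 / (R.Gfr 3 + 1) := hUle.trans (min_le_right _ _)
  have hVβ : β ^ 2 ≤ (V : ℝ) := EngineV8.sq_le_of_klEngL₃_le hV3
  have hMβ : β ≤ (M : ℝ) := EngineV8.le_of_klEngM₃_le hβmin hL3 hM3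
  obtain ⟨A₃, K₃, hA3, hK3, hdatA, hdatK⟩ := klFlowFrameU_thirdOrder_data (j := j) hR2 hU hUG hn1 hhist hnf hwin
  exact h R hRj cc U hcc hcle hU hU3 β hβmin hβc μ hμ _ hfr A₃ K₃ hA3 hK3 V M hVβ hMβ nf hnf hnfN hdatA hdatK Λw hΛw0 hΛwle X t ℓ

/-- **M3b-j (ii) BY NAME at a common frame on two lattices**: the sectional datum BUNDLED as
`TwoVolumeDefect.ScaleCovSecData (S_V(F̃_nf)ᵀ·klSliceCov_V (nf+j)·S_V(F̃_nf))[K_n] Λ_w Ce` for every lattice `V` with `klEngL₃ β U ≤ V` (M5's `hCsec` at `V := L″`,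
`nf := j`, door `j := 2`), deep window, every rate `0 ≤ Λ_w ≤ Λ_{nf+j}`. [cite: BenfattoGiulianiMastropietro2006, §2.8 (2.81), §3 (3.3)] -/
theorem scaleCovSecData_klSliceCov_bgmFat_klEng_flow_deep_vol (j dd : ℕ) :
    ∃ Ce : ℝ, 0 < Ce ∧
      ∀ (G : GeoConsts) (P : SplitConsts) (R : RenConsts) (Q : EngConsts) (cc : ℝ), R.WF2 → 0 < cc → cc ≤ EngineV8.klEngC₃6 P R →
      ∀ μ ∈ klWindowC, ∀ U : ℝ, 0 < U → U ≤ min (EngineV8.klEngU₀3 P R cc) (1 / (R.Gfr 3 + 1)) →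
      ∀ β : ℝ, klBetaMin ≤ β → β ≤ Real.exp (cc / U ^ 2) →
      ∀ (L M : ℕ) [NeZero L] [NeZero M], EngineV8.klEngL₃ β U ≤ L → EngineV8.klEngM₃ β U L ≤ M →
      ∀ n : ℕ, 1 ≤ n → n ≤ nScales β + 1 →
        HistP klPredsV17F2 L M G P Q R β U μ 0 n → FrameOK R U (nScales β) μ (klFlowFrameU L M β U μ n) →
        ∀ (V : ℕ) [NeZero V], EngineV8.klEngL₃ β U ≤ V →
        ∀ nf : ℕ, 1 ≤ nf → nf + j ≤ nScales β + 1 → (4 : ℝ) ^ (n + 2) * U ≤ (4 : ℝ) ^ (2 * nf + dd) →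
        ∀ Λw : ℝ, 0 ≤ Λw → Λw ≤ klScale klE0 (nf + j) →
          TwoVolumeDefect.ScaleCovSecData
            ((sectorSubMatrix V M β (bgmFatMultiplier V M klE0 β (nambuXiCT V μ (klFlowFrameU L M β U μ n)) nf)).transpose *
              klSliceCov V M β μ (klFlowFrameU L M β U μ n) (nf + j) *
              sectorSubMatrix V M β (bgmFatMultiplier V M klE0 β (nambuXiCT V μ (klFlowFrameU L M β U μ n)) nf)) Λw Ce := by
  obtain ⟨Ce, hCe, h⟩ := secWt_klSliceCov_bgmFat_klEng_flow_deep_vol j dd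
  refine ⟨Ce, hCe, ?_⟩
  intro G P R Q cc hR2 hcc hcc6 μ hμ U hU hUle β hβmin hβc L M _ _ hL3 hM3 n hn1 hnN hhist hfr V _ hV3 nf hnf hnfN hwin Λw hΛw0 hΛwle
  exact ⟨h G P R Q cc hR2 hcc hcc6 μ hμ U hU hUle β hβmin hβc L M hL3 hM3 n hn1 hnN hhist hfr V hV3 nf hnf hnfN hwin Λw hΛw0 hΛwle⟩

end Summit.HubbardSuperconductivity.HubbardSuperconductivity.Theorems.TorusFourierL2

end
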